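import Summits.BirchSwinnertonDyer.Rank1Residual.GaloisImage.ResidualTauOfSurj
import HarnessLib

/-!
# `GL₂(𝔽₃)`: every coset of the commutator subgroup contains a fixed-point-free element — the
# finite-group input of the Chebotarev supply for the certificate (C2′) of crux
# `KatoKuriharaPortThreeShared` (stmt-BirchSwinnertonDyer-19560; cell `bsd-addord`, seat w2-c3 gen 4)

Route W2 `KimAtThreeKolyvagin`, §U child 19560 of crux 19076 `DeepUpperAtThree`; consumer
`Theorems/KimAtThreePortSharedC2Chebotarev.lean` (a good prime `q ≡ u (mod M)` with `3 ∤ #Ẽ(𝔽_q)`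
under surj(3)).  THEOREMS ONLY (no definition, no named fact); a TOOL file about `GL₂(𝔽₃)`; closes
nothing by itself.

## What is proved

* `upper_mem_commutator` / `lower_mem_commutator` — the transvections `(1 x; 0 1)`, `(1 0; c 1)` lie
  in `[GL₂(𝔽₃), GL₂(𝔽₃)]`: `(1 1; 0 1) = ⁅diag(2,1), (1 1; 0 1)⁆` (tree
  `GL2.commutatorElement_diagTwo_shear`), `(1 0; 1 1) = ⁅diag(1,2), (1 0; 1 1)⁆`, squares for `x = 2`.
* `mem_commutator_of_det_eq_one` — **`SL₂(𝔽₃) ≤ [GL₂(𝔽₃), GL₂(𝔽₃)]`**: a determinant-one `C` with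
  lower-left entry `c ≠ 0` is `(1 (a−1)c; 0 1)(1 0; c 1)(1 (d−1)c; 0 1)` (Bruhat-type factorisation,
  `c² = 1` in `𝔽₃`); if `c = 0`, apply this to `(1 0; 1 1)·C`.
* `exists_mem_commutator_mul_forall_mulVec_ne` — for every `B ∈ GL₂(𝔽₃)` some `C` in the
  commutator subgroup has `B·C` fixing no non-zero vector of `𝔽₃²` (`B·C = −1` if `det B = 1`,
  `B·C = (1 1; 1 0)` if `det B = −1`).

References: J.-P. Serre, Invent. Math. 15 (1972) §2 (subgroups of `GL₂(𝔽_p)`) [Serre1972].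
-/

-- every file of this route lives in `Summit.BirchSwinnertonDyer.BirchSwinnertonDyer.Theorems.*` (summit =
-- problem name), so the duplicated-namespace linter is moot here (as in kim3's `KimAtThreeKolyvaginPortShared`).
set_option linter.dupNamespace false

noncomputable section

open scoped commutatorElement
open Matrix

namespace Summit.BirchSwinnertonDyer.BirchSwinnertonDyer.Theorems.KimAtThreePortSharedC2GL2

/-! ### Transvections are commutators -/

/-- **`(1 1; 0 1) ∈ [GL₂(𝔽₃), GL₂(𝔽₃)]`**: `⁅diag(2,1), (1 1; 0 1)⁆ = (1 1; 0 1)` (tree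
`GL2.commutatorElement_diagTwo_shear`, `2 ≠ 0` in `𝔽₃`). [folklore] -/
theorem upper_one_mem_commutator (g : GL (Fin 2) (ZMod 3))
    (hg : (g : Matrix (Fin 2) (Fin 2) (ZMod 3)) = !![1, 1; 0, 1]) :
    g ∈ commutator (GL (Fin 2) (ZMod 3)) := by
  have h2 : (2 : ZMod 3) ≠ 0 := by decide
  have hU : g = Matrix.GeneralLinearGroup.mkOfDetNeZero !![(1 : ZMod 3), 1; 0, 1]
      (by rw [Matrix.det_fin_two_of]; simp) := Units.ext hg
  rw [hU, ← Summit.BirchSwinnertonDyer.Rank1Residual.GaloisImage.GL2.commutatorElement_diagTwo_shear h2,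
    commutator_def]
  exact Subgroup.commutator_mem_commutator (Subgroup.mem_top _) (Subgroup.mem_top _)

/-- **`(1 0; 1 1) ∈ [GL₂(𝔽₃), GL₂(𝔽₃)]`**: `⁅diag(1,2), (1 0; 1 1)⁆ = (1 0; 1 1)`
(`diag(1,a) v diag(1,a)⁻¹ = v^a` for `v = (1 0; 1 1)`, `a = 2`). [folklore] -/
theorem lower_one_mem_commutator (g : GL (Fin 2) (ZMod 3))
    (hg : (g : Matrix (Fin 2) (Fin 2) (ZMod 3)) = !![1, 0; 1, 1]) :
    g ∈ commutator (GL (Fin 2) (ZMod 3)) := by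
  have h2 : (2 : ZMod 3) ≠ 0 := by decide
  set A : GL (Fin 2) (ZMod 3) := Matrix.GeneralLinearGroup.mkOfDetNeZero !![(1 : ZMod 3), 0; 0, 2]
    (by rw [Matrix.det_fin_two_of]; simpa using h2) with hA
  have hAv : (A : Matrix (Fin 2) (Fin 2) (ZMod 3)) = !![(1 : ZMod 3), 0; 0, 2] := rfl
  have hAB : A * g = g * g * A := by
    apply Matrix.GeneralLinearGroup.ext
    intro i j
    rw [Matrix.GeneralLinearGroup.coe_mul, Matrix.GeneralLinearGroup.coe_mul,
      Matrix.GeneralLinearGroup.coe_mul, hAv, hg]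
    fin_cases i <;> fin_cases j <;> norm_num [Matrix.mul_apply, Fin.sum_univ_two]
  have hcomm : ⁅A, g⁆ = g := by
    calc ⁅A, g⁆ = A * g * A⁻¹ * g⁻¹ := commutatorElement_def A g
      _ = g * g * A * A⁻¹ * g⁻¹ := by rw [hAB]
      _ = g := by rw [mul_inv_cancel_right, mul_inv_cancel_right]
  rw [← hcomm, commutator_def]
  exact Subgroup.commutator_mem_commutator (Subgroup.mem_top _) (Subgroup.mem_top _)

/-- Every upper transvection `(1 x; 0 1)` (`x ∈ 𝔽₃`) lies in the commutator subgroup (`x = 0`: the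
identity; `x = 1`: `upper_one_mem_commutator`; `x = 2`: the square of `(1 1; 0 1)`). [folklore] -/
theorem upper_mem_commutator (x : ZMod 3) (g : GL (Fin 2) (ZMod 3))
    (hg : (g : Matrix (Fin 2) (Fin 2) (ZMod 3)) = !![1, x; 0, 1]) :
    g ∈ commutator (GL (Fin 2) (ZMod 3)) := by
  have h3 : ∀ t : ZMod 3, t = 0 ∨ t = 1 ∨ t = 2 := by decide
  rcases h3 x with rfl | rfl | rfl
  · have h1 : g = 1 := by
      apply Units.ext; rw [hg, Units.val_one]
      ext i j; fin_cases i <;> fin_cases j <;> simp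
    rw [h1]; exact one_mem _
  · exact upper_one_mem_commutator g hg
  · set t : GL (Fin 2) (ZMod 3) := Matrix.GeneralLinearGroup.mkOfDetNeZero !![(1 : ZMod 3), 1; 0, 1]
      (by rw [Matrix.det_fin_two_of]; simp) with ht
    have htv : (t : Matrix (Fin 2) (Fin 2) (ZMod 3)) = !![(1 : ZMod 3), 1; 0, 1] := rfl
    have hgt : g = t * t := by
      apply Units.ext; rw [hg, Units.val_mul, htv]
      ext i j; fin_cases i <;> fin_cases j <;> simp [Matrix.mul_apply, Fin.sum_univ_two]; decide
    rw [hgt]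
    exact mul_mem (upper_one_mem_commutator t htv) (upper_one_mem_commutator t htv)

/-- Every lower transvection `(1 0; c 1)` (`c ∈ 𝔽₃`) lies in the commutator subgroup. [folklore] -/
theorem lower_mem_commutator (c : ZMod 3) (g : GL (Fin 2) (ZMod 3))
    (hg : (g : Matrix (Fin 2) (Fin 2) (ZMod 3)) = !![1, 0; c, 1]) :
    g ∈ commutator (GL (Fin 2) (ZMod 3)) := by
  have h3 : ∀ t : ZMod 3, t = 0 ∨ t = 1 ∨ t = 2 := by decide
  rcases h3 c with rfl | rfl | rfl
  · have h1 : g = 1 := by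
      apply Units.ext; rw [hg, Units.val_one]
      ext i j; fin_cases i <;> fin_cases j <;> simp
    rw [h1]; exact one_mem _
  · exact lower_one_mem_commutator g hg
  · set t : GL (Fin 2) (ZMod 3) := Matrix.GeneralLinearGroup.mkOfDetNeZero !![(1 : ZMod 3), 0; 1, 1]
      (by rw [Matrix.det_fin_two_of]; simp) with ht
    have htv : (t : Matrix (Fin 2) (Fin 2) (ZMod 3)) = !![(1 : ZMod 3), 0; 1, 1] := rfl
    have hgt : g = t * t := by
      apply Units.ext; rw [hg, Units.val_mul, htv]
      ext i j; fin_cases i <;> fin_cases j <;> simp [Matrix.mul_apply, Fin.sum_univ_two]; decide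
    rw [hgt]
    exact mul_mem (lower_one_mem_commutator t htv) (lower_one_mem_commutator t htv)

/-! ### `SL₂(𝔽₃)` lies in the commutator subgroup -/

/-- In `𝔽₃` a non-zero element squares to `1`. [folklore] -/
theorem mul_self_eq_one_of_ne_zero {c : ZMod 3} (hc : c ≠ 0) : c * c = 1 := by
  have h3 : ∀ t : ZMod 3, t ≠ 0 → t * t = 1 := by decide
  exact h3 c hc

/-- **Bruhat-type factorisation**: a determinant-one `C ∈ GL₂(𝔽₃)` with non-zero lower-left entry
`c` is `(1 (a−1)c; 0 1)·(1 0; c 1)·(1 (d−1)c; 0 1)`, hence lies in the commutator subgroup. [folklore] -/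
theorem mem_commutator_of_det_eq_one_of_ne_zero (C : GL (Fin 2) (ZMod 3))
    (hdet : (C : Matrix (Fin 2) (Fin 2) (ZMod 3)) 0 0 * (C : Matrix (Fin 2) (Fin 2) (ZMod 3)) 1 1 -
      (C : Matrix (Fin 2) (Fin 2) (ZMod 3)) 0 1 * (C : Matrix (Fin 2) (Fin 2) (ZMod 3)) 1 0 = 1)
    (hc : (C : Matrix (Fin 2) (Fin 2) (ZMod 3)) 1 0 ≠ 0) :
    C ∈ commutator (GL (Fin 2) (ZMod 3)) := by
  set a := (C : Matrix (Fin 2) (Fin 2) (ZMod 3)) 0 0 with ha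
  set b := (C : Matrix (Fin 2) (Fin 2) (ZMod 3)) 0 1 with hb
  set c := (C : Matrix (Fin 2) (Fin 2) (ZMod 3)) 1 0 with hc'
  set d := (C : Matrix (Fin 2) (Fin 2) (ZMod 3)) 1 1 with hd
  have hc2 : c * c = 1 := mul_self_eq_one_of_ne_zero hc
  -- the three factors
  set U₁ : GL (Fin 2) (ZMod 3) := Matrix.GeneralLinearGroup.mkOfDetNeZero !![1, (a - 1) * c; 0, 1]
    (by rw [Matrix.det_fin_two_of]; simp) with hU₁
  set V₁ : GL (Fin 2) (ZMod 3) := Matrix.GeneralLinearGroup.mkOfDetNeZero !![1, 0; c, 1]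
    (by rw [Matrix.det_fin_two_of]; simp) with hV₁
  set U₂ : GL (Fin 2) (ZMod 3) := Matrix.GeneralLinearGroup.mkOfDetNeZero !![1, (d - 1) * c; 0, 1]
    (by rw [Matrix.det_fin_two_of]; simp) with hU₂
  have hU₁v : (U₁ : Matrix (Fin 2) (Fin 2) (ZMod 3)) = !![1, (a - 1) * c; 0, 1] := rfl
  have hV₁v : (V₁ : Matrix (Fin 2) (Fin 2) (ZMod 3)) = !![1, 0; c, 1] := rfl
  have hU₂v : (U₂ : Matrix (Fin 2) (Fin 2) (ZMod 3)) = !![1, (d - 1) * c; 0, 1] := rfl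
  have hC : C = U₁ * V₁ * U₂ := by
    apply Units.ext
    rw [Units.val_mul, Units.val_mul, hU₁v, hV₁v, hU₂v, Matrix.eta_fin_two (C : Matrix (Fin 2) (Fin 2) (ZMod 3))]
    rw [← ha, ← hb, ← hc', ← hd]
    ext i j
    fin_cases i <;> fin_cases j
    · simp [Matrix.mul_apply, Fin.sum_univ_two]
      linear_combination (-(a - 1)) * hc2
    · simp [Matrix.mul_apply, Fin.sum_univ_two]
      linear_combination (-((a - 1) * (d - 1) * c + b)) * hc2 - c * hdet
    · simp [Matrix.mul_apply, Fin.sum_univ_two]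
    · simp [Matrix.mul_apply, Fin.sum_univ_two]
      linear_combination (-(d - 1)) * hc2
  rw [hC]
  exact mul_mem (mul_mem (upper_mem_commutator _ U₁ hU₁v) (lower_mem_commutator _ V₁ hV₁v))
    (upper_mem_commutator _ U₂ hU₂v)

/-- **`SL₂(𝔽₃) ≤ [GL₂(𝔽₃), GL₂(𝔽₃)]`**: every determinant-one element of `GL₂(𝔽₃)` lies in the
commutator subgroup (if the lower-left entry vanishes, first multiply by `(1 0; 1 1)`). [folklore] -/
theorem mem_commutator_of_det_eq_one (C : GL (Fin 2) (ZMod 3))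
    (hdet : Matrix.det (C : Matrix (Fin 2) (Fin 2) (ZMod 3)) = 1) :
    C ∈ commutator (GL (Fin 2) (ZMod 3)) := by
  rw [Matrix.det_fin_two] at hdet
  by_cases hc : (C : Matrix (Fin 2) (Fin 2) (ZMod 3)) 1 0 ≠ 0
  · exact mem_commutator_of_det_eq_one_of_ne_zero C hdet hc
  · push Not at hc
    set V₁ : GL (Fin 2) (ZMod 3) := Matrix.GeneralLinearGroup.mkOfDetNeZero !![(1 : ZMod 3), 0; 1, 1]
      (by rw [Matrix.det_fin_two_of]; simp) with hV₁
    have hV₁v : (V₁ : Matrix (Fin 2) (Fin 2) (ZMod 3)) = !![(1 : ZMod 3), 0; 1, 1] := rfl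
    -- `C' = V₁ * C` has lower-left entry `a ≠ 0` and determinant one
    set C' : GL (Fin 2) (ZMod 3) := V₁ * C with hC'
    have h10 : (C' : Matrix (Fin 2) (Fin 2) (ZMod 3)) 1 0 = (C : Matrix (Fin 2) (Fin 2) (ZMod 3)) 0 0 := by
      rw [hC', Units.val_mul, hV₁v]
      simp [Matrix.mul_apply, Fin.sum_univ_two, hc]
    have h00 : (C' : Matrix (Fin 2) (Fin 2) (ZMod 3)) 0 0 = (C : Matrix (Fin 2) (Fin 2) (ZMod 3)) 0 0 := by
      rw [hC', Units.val_mul, hV₁v]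
      simp [Matrix.mul_apply, Fin.sum_univ_two]
    have h01 : (C' : Matrix (Fin 2) (Fin 2) (ZMod 3)) 0 1 = (C : Matrix (Fin 2) (Fin 2) (ZMod 3)) 0 1 := by
      rw [hC', Units.val_mul, hV₁v]
      simp [Matrix.mul_apply, Fin.sum_univ_two]
    have h11 : (C' : Matrix (Fin 2) (Fin 2) (ZMod 3)) 1 1 =
        (C : Matrix (Fin 2) (Fin 2) (ZMod 3)) 0 1 + (C : Matrix (Fin 2) (Fin 2) (ZMod 3)) 1 1 := by
      rw [hC', Units.val_mul, hV₁v]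
      simp [Matrix.mul_apply, Fin.sum_univ_two]
    have ha : (C : Matrix (Fin 2) (Fin 2) (ZMod 3)) 0 0 ≠ 0 := by
      intro h0
      rw [h0, hc] at hdet
      simp at hdet
    have hdet' : (C' : Matrix (Fin 2) (Fin 2) (ZMod 3)) 0 0 * (C' : Matrix (Fin 2) (Fin 2) (ZMod 3)) 1 1 -
        (C' : Matrix (Fin 2) (Fin 2) (ZMod 3)) 0 1 * (C' : Matrix (Fin 2) (Fin 2) (ZMod 3)) 1 0 = 1 := by
      rw [h00, h11, h01, h10]
      rw [hc, mul_zero, sub_zero] at hdet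
      linear_combination hdet
    have hC'mem : C' ∈ commutator (GL (Fin 2) (ZMod 3)) :=
      mem_commutator_of_det_eq_one_of_ne_zero C' hdet' (by rw [h10]; exact ha)
    have hCeq : C = V₁⁻¹ * C' := by rw [hC', inv_mul_cancel_left]
    rw [hCeq]
    exact mul_mem (inv_mem (lower_mem_commutator _ V₁ hV₁v)) hC'mem

/-! ### Fixed-point-free representatives in each coset -/

/-- **Every coset of `[GL₂(𝔽₃), GL₂(𝔽₃)]` contains a fixed-point-free element**: for every
`B ∈ GL₂(𝔽₃)` there is `C` in the commutator subgroup with `B·C` fixing no non-zero vector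
(`B·C = −1` if `det B = 1`, `B·C = (1 1; 1 0)` — characteristic polynomial `X² − X − 1`, no root
`1` — if `det B = −1`; in both cases `det (B⁻¹·(B·C)) = 1`). [folklore] -/
theorem exists_mem_commutator_mul_forall_mulVec_ne (B : GL (Fin 2) (ZMod 3)) :
    ∃ C ∈ commutator (GL (Fin 2) (ZMod 3)), ∀ w : Fin 2 → ZMod 3,
      ((B * C : GL (Fin 2) (ZMod 3)) : Matrix (Fin 2) (Fin 2) (ZMod 3)) *ᵥ w = w → w = 0 := by
  -- the determinant of `B` is a non-zero element of `𝔽₃`, i.e. `1` or `2`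
  have hdetB : Matrix.det (B : Matrix (Fin 2) (Fin 2) (ZMod 3)) ≠ 0 := by
    have h := B.isUnit
    rw [Matrix.isUnit_iff_isUnit_det] at h
    exact h.ne_zero
  have hcases : ∀ t : ZMod 3, t ≠ 0 → t = 1 ∨ t = 2 := by decide
  -- `det B⁻¹ · det B = 1`
  have hinvmul : Matrix.det ((B⁻¹ : GL (Fin 2) (ZMod 3)) : Matrix (Fin 2) (Fin 2) (ZMod 3)) *
      Matrix.det (B : Matrix (Fin 2) (Fin 2) (ZMod 3)) = 1 := by
    rw [← Matrix.det_mul, ← Units.val_mul, inv_mul_cancel, Units.val_one, Matrix.det_one]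
  rcases hcases _ hdetB with hd | hd
  · -- `det B = 1`: take `B·C = −1`
    set A : GL (Fin 2) (ZMod 3) := Matrix.GeneralLinearGroup.mkOfDetNeZero !![(2 : ZMod 3), 0; 0, 2]
      (by rw [Matrix.det_fin_two_of]; decide) with hA
    have hAv : (A : Matrix (Fin 2) (Fin 2) (ZMod 3)) = !![(2 : ZMod 3), 0; 0, 2] := rfl
    refine ⟨B⁻¹ * A, mem_commutator_of_det_eq_one _ ?_, fun w hw => ?_⟩
    · rw [Units.val_mul, Matrix.det_mul]
      rw [hd, mul_one] at hinvmul
      rw [hinvmul, one_mul, hAv, Matrix.det_fin_two_of]; decide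
    · rw [mul_inv_cancel_left, hAv] at hw
      have h0 := congrFun hw 0
      have h1 := congrFun hw 1
      simp only [Matrix.mulVec, dotProduct, Fin.sum_univ_two, Matrix.of_apply, Matrix.cons_val_zero,
        Matrix.cons_val_one, zero_mul, add_zero, zero_add, Fin.isValue] at h0 h1
      have h2 : ∀ t : ZMod 3, 2 * t = t → t = 0 := by decide
      funext i
      fin_cases i
      · simpa using h2 _ h0
      · simpa using h2 _ h1
  · -- `det B = 2 = −1`: take `B·C = (1 1; 1 0)`
    set A : GL (Fin 2) (ZMod 3) := Matrix.GeneralLinearGroup.mkOfDetNeZero !![(1 : ZMod 3), 1; 1, 0]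
      (by rw [Matrix.det_fin_two_of]; decide) with hA
    have hAv : (A : Matrix (Fin 2) (Fin 2) (ZMod 3)) = !![(1 : ZMod 3), 1; 1, 0] := rfl
    refine ⟨B⁻¹ * A, mem_commutator_of_det_eq_one _ ?_, fun w hw => ?_⟩
    · rw [Units.val_mul, Matrix.det_mul]
      rw [hd] at hinvmul
      have h' : ∀ t : ZMod 3, t * 2 = 1 → t = 2 := by decide
      rw [h' _ hinvmul, hAv, Matrix.det_fin_two_of]; decide
    · rw [mul_inv_cancel_left, hAv] at hw
      have h0 := congrFun hw 0
      have h1 := congrFun hw 1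
      simp only [Matrix.mulVec, dotProduct, Fin.sum_univ_two, Matrix.of_apply, Matrix.cons_val_zero,
        Matrix.cons_val_one, one_mul, zero_mul, add_zero, Fin.isValue] at h0 h1
      -- `h0 : w 0 + w 1 = w 0`, `h1 : w 0 = w 1`
      have hw1 : w 1 = 0 := by linear_combination h0
      have hw0 : w 0 = 0 := by linear_combination h1 + h0
      funext i
      fin_cases i
      · simpa using hw0
      · simpa using hw1

end Summit.BirchSwinnertonDyer.BirchSwinnertonDyer.Theorems.KimAtThreePortSharedC2GL2

end
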